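import Literature.Computability.FineGrained.NSETHNonReducibility
import Literature.Computability.FineGrained.NSETHSparseTransfer
import Literature.Computability.FineGrained.SethOfNseth
import Literature.Computability.FineGrained.CliqueETHPositionGraph
import HarnessLib

/-!
# NSETH and the non-reducibility of CNF-SAT to APSP (Carmosino et al., ITCS 2016): decomposition

The APSP twin of `Literature.Computability.FineGrained.NSETHNonReducibility` (which treats 3SUM).
This file decomposes the named fact
`Literature.Computability.FineGrained.not_fgReducible_cnfSATWithSize_apsp_of_nseth`
(**fine-grained.S20**, `SETHHardness.lean`): assuming `NSETH`, for every `c ≥ 2` and every weight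
exponent `c'` there is no deterministic fine-grained reduction from `(CNFSATWithSize c, 2ⁿ)` to
`(APSP c', n³)` — along the chain of the 3SUM file, and proves everything on that chain except the
change of machine model: the canonical APSP oracle and step 1 (a reduction is an exponential-time
oracle program) are proved; the assemblies `not_fgReducible_cnfSATWithSize_apsp_of_nseth_of_bridge`
and `not_fgReducible_cnfSATWithSize_apsp_of_nseth_of_oracleElim` then derive the target from,
respectively, (a) the APSP twin of the sibling's machine-model fact, taken as an explicit hypothesis,
or (b) the sibling's machine-model fact ITSELF (`sparseKSATInExpTime_of_cnfSATInThreeSumOracleRAMTime`,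
an existing named fact) plus a purely word-RAM hypothesis — the elimination of the APSP oracle inside
the word RAM —, using two theorems already proved in the tree
(`kSATInExpTime_of_sparseKSATInExpTime_of_exponent` of `NSETHSparseTransfer.lean`,
`kTAUTInNExpTime_of_kSATInExpTime_holds` of `SatAlgorithmsTautProofs.lean`). No new named fact is
vendored here (D-0026: this is the proving seat of the target; the one missing step is recorded as a
hypothesis, in the two equivalent-purpose forms (a)/(b), for the seat that will prove it).

## The source

M. L. Carmosino, J. Gao, R. Impagliazzo, I. Mihajlin, R. Paturi, S. Schneider, *Nondeterministic
extensions of the Strong Exponential Time Hypothesis and consequences for non-reducibility*,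
ITCS 2016. NSETH (§1, Def. 1): for every `ε > 0` there is `k` with `k`-TAUT ∉ `NTIME[2^{n(1-ε)}]`.
Theorem 2 (§5): if NSETH holds and `C ∈ (N ∩ coN)TIME[T_C]`, then `(SAT, 2ⁿ)` does not
fine-grained reduce (deterministically; §3, Def. 1, Lemma 1, Cor. 1) to `(C, T_C^{1+γ})` for any
`γ > 0`. Theorem 3 (§5, APSP bullet, with §5.6: Lemma 10 — counting zero-weight triangles modulo
`p` in `O(n^ω p)` —, the Zero-Weight-Triangle lemma following it, `ZWT ∈ (N ∩ coN)TIME[Õ(n^{(3+ω)/2})]`,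
and its corollary for Negative Triangle and APSP): under NSETH there is no deterministic fine-grained
reduction from SAT to APSP with `T(n) = n^{(3+ω)/2+γ}`, `γ > 0`. Since `ω < 2.81` (Strassen 1969),
the vendored statement — threshold `n³` for `CNFSATWithSize c`, `c ≥ 2` — is the case
`γ = 3 - (3+ω)/2 > 0`; it is implied by, and weaker than, the printed theorem.

## The machine models of the vendored statement, and the route taken here

Exactly as for 3SUM (module docstring of `NSETHNonReducibility.lean`): `NSETH` speaks about
nondeterministic multi-stack Turing machines (`KTAUTInNExpTime`), `FGReducible` about deterministic
word-RAM oracle programs at word size `k · width x` — `O(log n)`-bit words for `CNFSATWithSize c`.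
The sibling file left APSP aside ("APSP is a function problem with long answers, for which the
polynomial-memory argument fails"); it does not fail, for the following reason. Along a run of a
word-RAM oracle program every `op` result is reduced modulo `2^w` or bounded by an immediate, and a
`query` writes the answer words reduced modulo `2^w` and the answer *length* unreduced
(`WordRAM.step`). The canonical APSP oracle `apspOracle` below answers a query `q = n :: rest` with
`|rest| = n²` by the encoded distance matrix, of length `n² + 1 = |q|`, and every other query by `[]`
— its answers are never longer than its questions (`length_apspOracle_le`), and a query length is
itself a memory value. Hence, by the induction of `WordRAM.run_memLE_of_queries`, every value,
address and query length stays `≤ V = max (2^{k · width x} - 1) (maxConst M) = poly(n)`: the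
reduction has polynomial memory and each of its (up to `⌊C 2^{(1-δ)n} + C⌋` many) queries is an APSP
instance on `≤ √V` nodes with weights of absolute value `≤ V`, answerable deterministically in
`poly(n)` steps (Floyd–Warshall / min-plus powering; the tree's verified word-RAM APSP program is
`APSP_inTimeO_cube_holds`, `APSPWordRAM.lean`). So, as for 3SUM, the `(N ∩ coN)TIME` half of the
printed proof (§5.6) is not needed at the threshold `n³` in this model; it is the *deterministic*
savings for CNF-SAT that are transferred (Lemma 1 of the source rather than Cor. 1), and NSETH
enters only at the end through `k`-TAUT ⊇ complement of `k`-SAT. (In print a SETH-hardness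
reduction may write one query of size `2^{Θ(n)}`, which `O(log n)`-bit words cannot address; in this
model `(CNFSATWithSize c, 2ⁿ) ≤_FG (B, b)` is a demanding notion and the fact a weak but faithful
rendering of Theorem 3 — see `SETHHardness.lean`.)

The chain:

1. (`cnfSATInAPSPOracleRAMTime_of_fgReducible`, proved) a fine-grained reduction
   `(CNFSATWithSize c, 2ⁿ) ≤_FG (APSP c', b)` (any `c'`, any budget `b`), taken at `ε = 1` with the
   oracle `apspOracle` (which answers every `APSP c'`, `APSP_oracleAnswers_apspOracle`), is a
   deterministic word-RAM oracle program deciding `CNFSATWithSize c` in `⌊C 2^{ρ n} + C⌋` steps for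
   some `0 ≤ ρ < 1` (`CNFSATInAPSPOracleRAMTime c ρ`);
2. (HYPOTHESIS — the change of machine model with the oracle answered by the simulating machine,
   route (a); or, route (b), the elimination of the APSP oracle inside the word RAM followed by the
   sibling's named fact `sparseKSATInExpTime_of_cnfSATInThreeSumOracleRAMTime`) hence, for `c ≥ 2`,
   sparse `k`-SAT is decided by multi-stack Turing machines in time `2^{(ρ+η)n} poly(L)` for all `k`,
   all densities and all `η > 0` (`SparseKSATInExpTime`);
3. (`kSATInExpTime_of_sparseKSATInExpTime_of_exponent`, PROVED in `NSETHSparseTransfer.lean`,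
   Impagliazzo–Paturi–Zane Cor. 2 in quantitative form over `sparsification_holds`) hence `k`-SAT is
   in `TIME(2^{(ρ+η)n} poly(L))` for all `k` and `η > 0`;
4. (`kTAUTInNExpTime_of_kSATInExpTime_holds`, PROVED in `SatAlgorithmsTautProofs.lean`) hence
   `k`-TAUT is in `NTIME(2^{(ρ+η)n} poly(L))` for all `k`, contradicting `NSETH` at `ε = (1-ρ)/2`.

Why step 2 is not proved here. Route (a) needs a multi-stack interpreter of oracle word-RAM
programs with cost polynomial *per step* in the memory bound (the tree's `WordRAM.ToTM2.runs_interp`,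
`WordRAMToTM2Interp.lean`, has cost polynomial in the *running time* and serves ETH granularity only)
together with a multi-stack APSP routine; route (b) needs a variant of the verified inline simulator
`WordRAM.Inline.SIM` (`WordRAMInline3.lean`, `FGComplexityProofs.lean`) whose scratch invalidation
survives `2^{ρ n}` oracle calls at `O(log n)`-bit words (its generation stamps and the side condition
`t ≤ 2 ^ (G w)` of `sim_numerics` presuppose a running time that fits in `O(1)` words), the sub-runs
being the verified cubic APSP program of `APSP_inTimeO_cube_holds` (`APSPWordRAM.lean`).

Not here: the `(N ∩ coN)TIME` algorithms of §5.6 (ZWT, Negative Triangle, APSP) and Cor. 1 /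
Thm. 2 in their printed generality — not needed at the threshold `n³` in this model (above).

## References

* M. L. Carmosino, J. Gao, R. Impagliazzo, I. Mihajlin, R. Paturi, S. Schneider, ITCS 2016, §1
  Def. 1, §3 Def. 1 and Lemma 1, §5 Thm. 2–3, §5.6. [key `CarmosinoEtAlITCS2016`; held, read as
  `paper:doi-10-1145-2840728-2840746`]
* V. Vassilevska Williams, *On some fine-grained questions in algorithms and complexity*,
  Proc. ICM 2018, §2 (word RAM, Def. 2.1, the remark after it). [key `VassilevskaWilliamsICM2018`]
* V. Vassilevska Williams, R. Williams, *Subcubic equivalences between path, matrix, and triangle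
  problems*, J. ACM 65 (2018), §1 (APSP, input format). [key `VassilevskaWilliamsWilliams2018`]
* R. Impagliazzo, R. Paturi, F. Zane, JCSS 63 (2001), Thm. 1, Cor. 1–2.
  [key `ImpagliazzoPaturiZaneJCSS2001`]
* S. A. Cook, R. A. Reckhow, *Time bounded random access machines*, JCSS 7 (1973), §2.
  [key `CookReckhow1973`]
* V. Strassen, *Gaussian elimination is not optimal*, Numer. Math. 13 (1969). [key `Strassen1969`]
-/

namespace Literature.Computability.FineGrained

open Cryptography Cryptography.WordRAM Complexity

/-! ### The canonical APSP oracle -/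

/-- Inverse of `encodeWithTopInt` (`⊤ ↦ 0`, `z ↦ encodeInt z + 1`): `0 ↦ ⊤`,
`m + 1 ↦ encodeInt⁻¹ m`. [folklore] -/
def decodeWithTopInt : ℕ → WithTop ℤ
  | 0 => ⊤
  | m + 1 => ((Equiv.intEquivNat.symm m : ℤ) : WithTop ℤ)

/-- `decodeWithTopInt` inverts `encodeWithTopInt`. [folklore] -/
@[simp] theorem decodeWithTopInt_encodeWithTopInt (a : WithTop ℤ) :
    decodeWithTopInt (encodeWithTopInt a) = a := by
  cases a with
  | top => rfl
  | coe z => simp [encodeWithTopInt, decodeWithTopInt, encodeInt]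

/-- Read an `n × n` matrix over `ℤ ∪ {∞}` off a word list in row-major order (entry `(i, j)` is word
`i n + j`, decoded by `decodeWithTopInt`; missing words read as `0 ↦ ⊤`). [folklore] -/
def decodeMatrixWords (n : ℕ) (l : List ℕ) : Matrix (Fin n) (Fin n) (WithTop ℤ) :=
  fun i j => decodeWithTopInt (l.getD (i * n + j) 0)

/-- The row-major entry words of `encodeMatrixWithTop W` (everything after the head `n`). [folklore] -/
theorem encodeMatrixWithTop_eq_cons {n : ℕ} (W : Matrix (Fin n) (Fin n) (WithTop ℤ)) :
    encodeMatrixWithTop W =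
      n :: (List.finRange n).flatMap fun i => (List.finRange n).map fun j =>
        encodeWithTopInt (W i j) :=
  rfl

/-- Decoding the entry words of an encoded matrix gives the matrix back. [folklore] -/
theorem decodeMatrixWords_encode {n : ℕ} (W : Matrix (Fin n) (Fin n) (WithTop ℤ)) :
    decodeMatrixWords n ((List.finRange n).flatMap fun i => (List.finRange n).map fun j =>
      encodeWithTopInt (W i j)) = W := by
  funext i j
  unfold decodeMatrixWords
  rw [List.getD_eq_getElem?_getD,
    getElem?_flatMap_const _ (List.finRange n) (fun a _ => by simp) i (by simp) j j.2]
  simp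

/-- The entry words of an encoded `n × n` matrix number `n²`. [folklore] -/
theorem length_entries_encodeMatrixWithTop {n : ℕ} (W : Matrix (Fin n) (Fin n) (WithTop ℤ)) :
    ((List.finRange n).flatMap fun i => (List.finRange n).map fun j =>
      encodeWithTopInt (W i j)).length = n ^ 2 := by
  have h := encodeMatrixWithTop_length W
  rw [encodeMatrixWithTop_eq_cons, List.length_cons] at h
  omega

/-- **The canonical APSP oracle.** On a query `n :: rest` with `|rest| = n²` — the shape of an
encoded `n × n` weight matrix — decode the matrix and answer the encoded matrix of its walk
distances `shortestDist` (the accepted output of `APSP c'` on every instance, whatever `c'`); on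
every other query answer `[]`. It answers `APSP c'` for every `c'`
(`APSP_oracleAnswers_apspOracle`), and its answers are never longer than its questions
(`length_apspOracle_le`) — the property that keeps the memory of an `O(log n)`-bit-word reduction
polynomial (module docstring). (VVW ICM 2018, Def. 2.1: oracle access to the target problem;
VW–W J. ACM 2018, §1: APSP outputs the distance matrix.) [cite: VassilevskaWilliamsICM2018, §2 Def. 2.1] -/
def apspOracle : List ℕ → List ℕ
  | [] => []
  | n :: rest => if rest.length = n ^ 2 then
      encodeMatrixWithTop (shortestDist (decodeMatrixWords n rest)) else []

/-- The canonical APSP oracle on a well-shaped query. [folklore] -/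
theorem apspOracle_cons_of_length {n : ℕ} {rest : List ℕ} (h : rest.length = n ^ 2) :
    apspOracle (n :: rest) = encodeMatrixWithTop (shortestDist (decodeMatrixWords n rest)) := by
  simp [apspOracle, h]

/-- **Answers are never longer than questions**: `|apspOracle q| ≤ |q|` (equality on well-shaped
queries, `0` otherwise). [folklore] -/
theorem length_apspOracle_le (q : List ℕ) : (apspOracle q).length ≤ q.length := by
  cases q with
  | nil => simp [apspOracle]
  | cons n rest =>
    by_cases h : rest.length = n ^ 2
    · rw [apspOracle_cons_of_length h, encodeMatrixWithTop_length, List.length_cons, h]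
    · simp [apspOracle, h]

/-- The canonical oracle on the encoding of a matrix answers its encoded distance matrix. [folklore] -/
theorem apspOracle_encodeMatrixWithTop {n : ℕ} (W : Matrix (Fin n) (Fin n) (WithTop ℤ)) :
    apspOracle (encodeMatrixWithTop W) = encodeMatrixWithTop (shortestDist W) := by
  rw [encodeMatrixWithTop_eq_cons W, apspOracle_cons_of_length (length_entries_encodeMatrixWithTop W),
    decodeMatrixWords_encode]

/-- **The canonical oracle answers `APSP c'`** for every weight exponent `c'`: on the encoding of an
instance it returns the unique accepted output, the encoded distance matrix (`APSP_good`). [folklore] -/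
theorem APSP_oracleAnswers_apspOracle (c' : ℕ) : (APSP c').OracleAnswers apspOracle := by
  intro W
  rw [APSP_good, Set.mem_singleton_iff]
  exact apspOracle_encodeMatrixWithTop W.1.2

/-! ### CNF-SAT with a polynomial clause budget on the word RAM with an APSP oracle -/

/-- `CNFSATInAPSPOracleRAMTime c ρ`: some deterministic word-RAM *oracle* program `M`, run with the
canonical APSP oracle `apspOracle` at word size `k · inputWidth (encodeCNFWords φ)` (the word size of
`FGReducible` on `CNFSATWithSize c`, i.e. `O(log n)`-bit words), halts on every CNF `φ` with
`numClauses φ + size φ ≤ (numVars φ + 1)ᶜ` (the instances of `CNFSATWithSize c`) within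
`⌊C · 2^{ρ n} + C⌋₊` steps, `n = numVars φ`, with an accepted output of `CNFSAT` (`[1]` iff `φ` is
satisfiable). The APSP twin of `CNFSATInThreeSumOracleRAMTime`: it is what a fine-grained reduction
`(CNFSATWithSize c, 2ⁿ) ≤_FG (APSP c', b)` delivers at a fixed `ε`
(`cnfSATInAPSPOracleRAMTime_of_fgReducible`), with nothing said about the ledger of the queries, and
the hypothesis of the change of machine model below. (VVW ICM 2018, Def. 2.1; Carmosino et al.
2016, §3 Def. 1 and Lemma 1.) [cite: VassilevskaWilliamsICM2018, §2 Def. 2.1] -/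
def CNFSATInAPSPOracleRAMTime (c : ℕ) (ρ : ℝ) : Prop :=
  ∃ (M : Program) (k : ℕ) (C : ℝ), M.IsDeterministic ∧
    ∀ φ : CNF ℕ, φ.numClauses + φ.size ≤ (φ.numVars + 1) ^ c →
      ∃ cfg : Cfg, HaltsWithin M (k * inputWidth (encodeCNFWords φ)) apspOracle zeroCoins
          (encodeCNFWords φ) ⌊C * (2 : ℝ) ^ (ρ * (φ.numVars : ℝ)) + C⌋₊ cfg ∧
        readOut cfg.mem ∈ CNFSAT.Good φ

/-- Monotonicity of `CNFSATInAPSPOracleRAMTime` in the exponent. [folklore] -/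
theorem CNFSATInAPSPOracleRAMTime.mono {c : ℕ} {ρ ρ' : ℝ} (h : CNFSATInAPSPOracleRAMTime c ρ)
    (hρ : ρ ≤ ρ') : CNFSATInAPSPOracleRAMTime c ρ' := by
  obtain ⟨M, k, C, hdet, hM⟩ := h
  refine ⟨M, k, max C 0, hdet, fun φ hφ => ?_⟩
  obtain ⟨cfg, hrun, hout⟩ := hM φ hφ
  refine ⟨cfg, hrun.mono (Nat.floor_le_floor ?_), hout⟩
  have h0 : (0 : ℝ) ≤ max C 0 := le_max_right _ _
  have h1 : (0 : ℝ) ≤ (2 : ℝ) ^ (ρ * (φ.numVars : ℝ)) := by positivity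
  have h2 : (2 : ℝ) ^ (ρ * (φ.numVars : ℝ)) ≤ (2 : ℝ) ^ (ρ' * (φ.numVars : ℝ)) :=
    Real.rpow_le_rpow_of_exponent_le (by norm_num)
      (mul_le_mul_of_nonneg_right hρ (Nat.cast_nonneg _))
  calc C * (2 : ℝ) ^ (ρ * (φ.numVars : ℝ)) + C
      ≤ max C 0 * (2 : ℝ) ^ (ρ * (φ.numVars : ℝ)) + max C 0 :=
        add_le_add (mul_le_mul_of_nonneg_right (le_max_left _ _) h1) (le_max_left _ _)
    _ ≤ max C 0 * (2 : ℝ) ^ (ρ' * (φ.numVars : ℝ)) + max C 0 := by gcongr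

/-- **Step 1 (proved): a fine-grained reduction to APSP is an exponential-time oracle program.**
If `(CNFSATWithSize c, 2ⁿ) ≤_FG (APSP c', b)` for some weight exponent `c'` and some budget `b`, then
— taking the reduction at `ε = 1` and running it with the canonical oracle `apspOracle`, which
answers `APSP c'` — some deterministic oracle program decides `CNFSATWithSize c` within
`⌊C 2^{ρ n} + C⌋₊` steps for an exponent `0 ≤ ρ < 1` (`ρ = 1 - min δ 1` for the `δ` of the
reduction). The ledger and the query-length charge of Def. 2.1 are forgotten. (Carmosino et al. 2016,
§3 Lemma 1: run the reduction, simulating the oracle calls; VVW ICM 2018, remark after Def. 2.1.)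
[cite: CarmosinoEtAlITCS2016, §3 Lemma 1] -/
theorem cnfSATInAPSPOracleRAMTime_of_fgReducible {c c' : ℕ} {b : ℕ → ℝ}
    (h : FGReducible (CNFSATWithSize c) (fun n => (2 : ℝ) ^ (n : ℝ)) (APSP c') b) :
    ∃ ρ : ℝ, 0 ≤ ρ ∧ ρ < 1 ∧ CNFSATInAPSPOracleRAMTime c ρ := by
  obtain ⟨δ, hδ, M, k, C, hdet, hM⟩ := h 1 one_pos
  refine ⟨1 - min δ 1, by have := min_le_right δ 1; linarith,
    by have := lt_min hδ one_pos; linarith, M, k, max C 0, hdet, fun φ hφ => ?_⟩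
  obtain ⟨cfg, bs, hrun, hgood, -, -, -⟩ :=
    hM apspOracle (APSP_oracleAnswers_apspOracle c') ⟨φ, hφ⟩
  refine ⟨cfg, hrun.mono (Nat.floor_le_floor ?_), hgood⟩
  -- `C (2ⁿ)^{1-δ} + C ≤ max C 0 · 2^{(1 - min δ 1) n} + max C 0`
  show C * ((2 : ℝ) ^ ((φ.numVars : ℕ) : ℝ)) ^ (1 - δ) + C ≤
    max C 0 * (2 : ℝ) ^ ((1 - min δ 1) * (φ.numVars : ℝ)) + max C 0
  rw [← Real.rpow_mul (by norm_num : (0 : ℝ) ≤ 2)]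
  have h0 : (0 : ℝ) ≤ max C 0 := le_max_right _ _
  have h1 : (0 : ℝ) ≤ (2 : ℝ) ^ ((φ.numVars : ℝ) * (1 - δ)) := by positivity
  have h2 : (2 : ℝ) ^ ((φ.numVars : ℝ) * (1 - δ)) ≤
      (2 : ℝ) ^ ((1 - min δ 1) * (φ.numVars : ℝ)) := by
    refine Real.rpow_le_rpow_of_exponent_le (by norm_num) ?_
    rw [mul_comm]
    exact mul_le_mul_of_nonneg_right (by have := min_le_left δ 1; linarith) (Nat.cast_nonneg _)
  calc C * (2 : ℝ) ^ ((φ.numVars : ℝ) * (1 - δ)) + C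
      ≤ max C 0 * (2 : ℝ) ^ ((φ.numVars : ℝ) * (1 - δ)) + max C 0 :=
        add_le_add (mul_le_mul_of_nonneg_right (le_max_left _ _) h1) (le_max_left _ _)
    _ ≤ max C 0 * (2 : ℝ) ^ ((1 - min δ 1) * (φ.numVars : ℝ)) + max C 0 := by gcongr

/-! ### Step 2: the change of machine model (hypothesis of the assemblies)

The APSP twin of the sibling's named fact `sparseKSATInExpTime_of_cnfSATInThreeSumOracleRAMTime`
reads: for `c ≥ 2` and `ρ ≥ 0`, `CNFSATInAPSPOracleRAMTime c ρ` implies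
`SparseKSATInExpTime k c' (ρ + η)` for all `k, c'` and `η > 0`. Why it holds (folklore; Cook–Reckhow
1973, §2: a random-access machine is simulated by a multitape Turing machine with polynomial
overhead, here *per step* because the memory is polynomial): pad `numVars` by the constant
`N = (k+1) c' + 3` with the tautological clause `x_{n+N-1} ∨ ¬x_{n+N-1}` so that the clause list is an
instance of `CNFSATWithSize 2 ⊆ CNFSATWithSize c` on `n + N` variables; at word size
`w = k · inputWidth x = O(log n)` every value, address and query length of the oracle run is
`≤ V = max (2^w - 1) (maxConst M) = poly(n)` — the induction of `WordRAM.run_memLE_of_queries` applies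
because `apspOracle` never answers more words than it was asked (`length_apspOracle_le`; the answer
length is the only quantity `WordRAM.step` writes unreduced) —, so the memory is a table of `poly(n)`
numerals of `O(log n)` bits, one RAM step costs `poly(n)` machine steps, and each `query q` is
answered by the simulating machine itself: check the shape `q = m :: rest`, `|rest| = m²`
(`m ≤ √V`), decode the matrix (entries of absolute value `≤ V`), compute `shortestDist` by `m`
min-plus products (`walkDistLE`) and write its encoding, `poly(n)` steps per query; in all
`2^{ρ n} · poly(n) ≤ C_η 2^{(ρ+η)n}` steps plus `poly(L)` for parsing. It is not vendored as a named
fact from this proving seat (D-0026); the assemblies below take it — route (a) —, or the word-RAM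
oracle elimination of route (b), as an explicit hypothesis. -/

/-! ### Assembly -/

/-- **Steps 2–4 assembled, route (a): an APSP-oracle program of exponent `ρ < 1` for
`CNFSATWithSize c`, `c ≥ 2`, refutes NSETH — given the change of machine model for APSP-oracle
programs** (hypothesis `h2`, the APSP twin of `sparseKSATInExpTime_of_cnfSATInThreeSumOracleRAMTime`,
see the section docstring above). From `CNFSATInAPSPOracleRAMTime c ρ` with `0 ≤ ρ < 1`: sparse
`k`-SAT (`h2`), then `k`-SAT (`kSATInExpTime_of_sparseKSATInExpTime_of_exponent`, proved), then
`k`-TAUT nondeterministically (`kTAUTInNExpTime_of_kSATInExpTime_holds`, proved) have exponent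
`ρ + (1-ρ)/2 = 1 - (1-ρ)/2` for every `k`, contradicting `NSETH` at `ε = (1-ρ)/2`.
(Carmosino et al. 2016, proof of Thm. 2.) [cite: CarmosinoEtAlITCS2016, §5 Thm. 2 (proof)] -/
theorem not_nseth_of_cnfSATInAPSPOracleRAMTime_of_bridge
    (h2 : ∀ (c : ℕ) (ρ : ℝ), 2 ≤ c → 0 ≤ ρ → CNFSATInAPSPOracleRAMTime c ρ →
      ∀ (k c' : ℕ) (η : ℝ), 0 < η → SparseKSATInExpTime k c' (ρ + η))
    {c : ℕ} (hc : 2 ≤ c) {ρ : ℝ} (hρ0 : 0 ≤ ρ) (hρ1 : ρ < 1)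
    (hram : CNFSATInAPSPOracleRAMTime c ρ) : ¬ NSETH := by
  intro hN
  have hη : 0 < (1 - ρ) / 2 := by linarith
  obtain ⟨k, -, hnot⟩ := hN ((1 - ρ) / 2) hη
  have hsat : KSATInExpTime k (ρ + (1 - ρ) / 2) :=
    kSATInExpTime_of_sparseKSATInExpTime_of_exponent hρ0
      (fun c' η hη' => h2 c ρ hc hρ0 hram k c' η hη') _ hη
  have e : ρ + (1 - ρ) / 2 = 1 - (1 - ρ) / 2 := by ring
  rw [e] at hsat
  exact hnot (kTAUTInNExpTime_of_kSATInExpTime_holds hsat)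

/-- **Assembly, route (a) (proved): the change of machine model for APSP-oracle programs implies
fine-grained.S20 for APSP verbatim.** Assuming `NSETH`, `c ≥ 2` and any weight exponent `c'`, a
fine-grained reduction `(CNFSATWithSize c, 2ⁿ) ≤_FG (APSP c', n³)` would give (step 1) an APSP-oracle
program of exponent `ρ < 1` for `CNFSATWithSize c`, hence (steps 2–4) refute `NSETH`. This is
Theorem 2/3 of Carmosino et al. for APSP at the threshold `n³`, in the word-RAM /
multi-stack-machine models of the tree, up to the one machine-model hypothesis `h2`.
[cite: CarmosinoEtAlITCS2016, §5 Thm. 2–3 (APSP)] -/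
theorem not_fgReducible_cnfSATWithSize_apsp_of_nseth_of_bridge
    (h2 : ∀ (c : ℕ) (ρ : ℝ), 2 ≤ c → 0 ≤ ρ → CNFSATInAPSPOracleRAMTime c ρ →
      ∀ (k c' : ℕ) (η : ℝ), 0 < η → SparseKSATInExpTime k c' (ρ + η)) :
    not_fgReducible_cnfSATWithSize_apsp_of_nseth := by
  intro hN c hc c' hred
  obtain ⟨ρ, hρ0, hρ1, hram⟩ := cnfSATInAPSPOracleRAMTime_of_fgReducible hred
  exact not_nseth_of_cnfSATInAPSPOracleRAMTime_of_bridge h2 hc hρ0 hρ1 hram hN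

/-- Route (a) for an arbitrary APSP budget `b` in place of `n³` (the argument never inspects the
ledger of the reduction: in this model no `(APSP c', b)` is SETH-hard under NSETH, for
`CNFSATWithSize c`, `c ≥ 2`, given the machine-model hypothesis).
[cite: CarmosinoEtAlITCS2016, §5 Thm. 2–3 (APSP)] -/
theorem not_fgReducible_cnfSATWithSize_apsp_budget_of_bridge
    (h2 : ∀ (c : ℕ) (ρ : ℝ), 2 ≤ c → 0 ≤ ρ → CNFSATInAPSPOracleRAMTime c ρ →
      ∀ (k c' : ℕ) (η : ℝ), 0 < η → SparseKSATInExpTime k c' (ρ + η))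
    (hN : NSETH) {c : ℕ} (hc : 2 ≤ c) (c' : ℕ) (b : ℕ → ℝ) :
    ¬ FGReducible (CNFSATWithSize c) (fun n => (2 : ℝ) ^ (n : ℝ)) (APSP c') b := by
  intro hred
  obtain ⟨ρ, hρ0, hρ1, hram⟩ := cnfSATInAPSPOracleRAMTime_of_fgReducible hred
  exact not_nseth_of_cnfSATInAPSPOracleRAMTime_of_bridge h2 hc hρ0 hρ1 hram hN

/-- **Assembly, route (b) (proved): the target from the sibling's EXISTING named fact plus the
elimination of the APSP oracle inside the word RAM.** If every APSP-oracle program for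
`CNFSATWithSize c` of exponent `ρ` can be turned into a 3SUM-oracle (e.g. oracle-free) program of
every exponent `ρ + η`, `η > 0` (hypothesis `helim` — a purely word-RAM statement: answer each query
inline by the verified cubic APSP program of `APSP_inTimeO_cube_holds`, each of the `≤ 2^{ρ n}`
queries having `poly(n)` size by `length_apspOracle_le` and `WordRAM.run_memLE_of_queries`), then the
machine-model fact of the 3SUM file, `sparseKSATInExpTime_of_cnfSATInThreeSumOracleRAMTime`, already
yields fine-grained.S20 for APSP (through `not_nseth_of_cnfSATInThreeSumOracleRAMTime` with the proved
steps 3–4). [cite: CarmosinoEtAlITCS2016, §5 Thm. 2–3 (APSP)] -/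
theorem not_fgReducible_cnfSATWithSize_apsp_of_nseth_of_oracleElim
    (helim : ∀ (c : ℕ) (ρ : ℝ), 0 ≤ ρ → CNFSATInAPSPOracleRAMTime c ρ →
      ∀ η : ℝ, 0 < η → CNFSATInThreeSumOracleRAMTime c (ρ + η))
    (h3 : sparseKSATInExpTime_of_cnfSATInThreeSumOracleRAMTime) :
    not_fgReducible_cnfSATWithSize_apsp_of_nseth := by
  intro hN c hc c' hred
  obtain ⟨ρ, hρ0, hρ1, hram⟩ := cnfSATInAPSPOracleRAMTime_of_fgReducible hred
  have hη : 0 < (1 - ρ) / 4 := by linarith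
  have hram' : CNFSATInThreeSumOracleRAMTime c (ρ + (1 - ρ) / 4) := helim c ρ hρ0 hram _ hη
  refine not_nseth_of_cnfSATInThreeSumOracleRAMTime h3
    (fun k ρ' hρ' h η hη' => kSATInExpTime_of_sparseKSATInExpTime_of_exponent hρ' h η hη')
    kTAUTInNExpTime_of_kSATInExpTime_holds hc (by linarith) (by linarith) hram' hN

end Literature.Computability.FineGrained
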